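import Literature.AnabelianGeometry.AbsoluteAnabelian.AbsTopIII.FunctionFieldSlimSubpadicProofs
import Literature.NumberTheory.GaloisRepresentations.AbsGaloisRestrictSurjective
import Literature.NumberTheory.DiophantineGeometry.FunctionFieldOnePointData
import HarnessLib

/-!
# [AbsTopIII] Theorem 1.11, slimness: the closed fact is EQUIVALENT to its conjunct (c)

S. Mochizuki, *Topics in absolute anabelian geometry III*, Theorem 1.11 (p. 45): for the function
field `K = K_X` of a curve over a Kummer-faithful field `k`, "`Δ_{η_X}`, `Π_{η_X}`, and `G_k` are
slim".  The cell records this as the three-conjunct closed fact `AbsTopIII.Thm_1_11_slim`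
(`BirationalReconstruction.lean`, FACT-LIST row F-0337).

ERRATUM (published, cf. `FunctionFieldSlimSubpadicProofs.lean`): conjunct (c) "`G_k` slim for
every Kummer-faithful `k`" is false in general — T. Asayama, arXiv:2601.10298 (2026), Cor. 1.5 /
Rmk. 1.6 (a Kummer-faithful algebraic extension of a number field with ABELIAN absolute Galois
group; author-acknowledged gap; the counterexample is non-constructive).

This proof-only file makes the status of the closed fact KERNEL-PRECISE:

* `absGaloisRestrict_surjective_of_isAlgFunctionField` — the hypothesis
  `hsurj : Function.Surjective (absGaloisRestrict k K)` carried by `genericPointExtension` and by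
  the fact is a THEOREM for every `K/k` with `k` algebraically closed in `K` (characteristic zero):
  Lang, *Algebra*, Ch. VI §1 Thm. 1.12, file `AbsGaloisRestrictSurjective.lean` (so consumers may
  write `genericPointExtension k K (absGaloisRestrict_surjective_of_isAlgFunctionField k K)`);
* `Thm_1_11_slim_iff_base` — `Thm_1_11_slim` holds (in universe `u`) IF AND ONLY IF every
  Kummer-faithful field `k : Type u` has slim absolute Galois group: `⇐` is w5-d231's
  `Thm_1_11_slim_of_base` (conjuncts (a), (b) are theorems); `⇒` evaluates the fact at the rational
  function field `K := k(X)` (`RatFunc k`: an algebraic function field of one variable with `k`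
  algebraically closed in it, `FunctionFieldOnePointData.isIntegrallyClosedIn_ratFunc`), whose
  `hsurj` is now a theorem.  Hence the row F-0337 stands or falls EXACTLY with Asayama's
  counterexample: it is refuted by any Kummer-faithful field (in the tree's sense, which the printed
  sense implies) with non-slim `G_k`, and by nothing else.
* `not_Thm_1_11_slim_of_exists` — the contrapositive, ready to consume such a field.

HONEST FRAMING: classical field/Galois theory; the erratum concerns a prerequisite paper
([AbsTopIII]) and is reported with its locator; F-0337 lies OUTSIDE the [IUTchIII] Cor. 3.12 cone
and nothing here bears on Cor. 3.12. [cite: MochizukiAbsTopIII2015, Thm 1.11 p.45]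
[cite: Asayama2026KummerFaithfulFG, Rmk 1.6]
-/

noncomputable section

open scoped Classical

namespace Literature.AnabelianGeometry.AbsoluteAnabelian.AbsTopIII

open Field
open Literature.NumberTheory.GaloisRepresentations (absGaloisRestrict
  absGaloisRestrict_surjective_of_isIntegrallyClosedIn)
open Literature.NumberTheory.DiophantineGeometry
open Literature.AlgebraicGeometry.Frobenioids (IsSlimGroup)

universe u

/-- The surjectivity hypothesis `hsurj` of `genericPointExtension k K` / `Thm_1_11_slim` /
`Thm_1_11` is a theorem: for `k` algebraically closed in `K` (`[IsIntegrallyClosedIn k K]`, e.g. the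
full constant field of a function field) of characteristic zero, `Gal(K̄/K) → Gal(k̄/k)` is onto
(Lang, *Algebra*, Ch. VI §1 Thm. 1.12, as `absGaloisRestrict_surjective_of_isIntegrallyClosedIn`).
[cite: Lang2002, Ch. VI §1 Thm 1.12] -/
theorem absGaloisRestrict_surjective_of_isAlgFunctionField (k K : Type u) [Field k] [Field K]
    [CharZero K] [Algebra k K] [IsIntegrallyClosedIn k K] :
    Function.Surjective (absGaloisRestrict k K) :=
  absGaloisRestrict_surjective_of_isIntegrallyClosedIn k K

/-- **`Thm_1_11_slim` ⟹ conjunct (c)**: if the closed fact holds, then every Kummer-faithful field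
`k` has slim absolute Galois group — evaluate the fact at the rational function field `k(X)`
(`k` is algebraically closed in `k(X)`; `Gal → Gal` onto by Lang VI.1.12).  By Asayama 2026
(Rmk. 1.6 / Cor. 1.5) the conclusion is false in general, so this is the precise sense in which the
printed conjunct (c) — and with it the closed fact — fails. [cite: MochizukiAbsTopIII2015, Thm 1.11 p.45]
[cite: Asayama2026KummerFaithfulFG, Rmk 1.6] -/
theorem isSlimGroup_absoluteGaloisGroup_of_Thm_1_11_slim (h : Thm_1_11_slim.{u})
    (k : Type u) [Field k] (hk : IsKummerFaithful k) :
    IsSlimGroup (Field.absoluteGaloisGroup k) := by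
  haveI : CharZero k := hk.torally.charZero
  haveI : CharZero (RatFunc k) :=
    charZero_of_injective_algebraMap (algebraMap k (RatFunc k)).injective
  exact (h k (RatFunc k) (absGaloisRestrict_surjective_of_isIntegrallyClosedIn k (RatFunc k)) hk).2.2

/-- **The closed fact `Thm_1_11_slim` is EQUIVALENT to its conjunct (c)** ("`G_k` slim for every
Kummer-faithful `k`"): conjuncts (a) `Π_{η_X}` slim (`Thm_1_11_slim_a`, w5-d231) and (b) `Δ_{η_X}`
slim (`isSlimGroup_geom_genericPointExtension`, every `k` of characteristic zero) are theorems, and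
(c) is recovered from the fact at `K = k(X)`.  Consequently F-0337 is refuted by — and only by — a
Kummer-faithful field with non-slim absolute Galois group (Asayama 2026: such fields exist, with
`G_k` abelian; non-constructive). [cite: MochizukiAbsTopIII2015, Thm 1.11 p.45]
[cite: Asayama2026KummerFaithfulFG, Cor 1.5] -/
theorem Thm_1_11_slim_iff_base :
    Thm_1_11_slim.{u} ↔
      ∀ (k : Type u) [Field k], IsKummerFaithful k → IsSlimGroup (Field.absoluteGaloisGroup k) :=
  ⟨fun h k _ hk => isSlimGroup_absoluteGaloisGroup_of_Thm_1_11_slim h k hk,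
    fun h => Thm_1_11_slim_of_base h⟩

/-- Contrapositive, ready to consume a counterexample: any Kummer-faithful field (in the tree's
sense, implied by the printed one) whose absolute Galois group is not slim — e.g. one with abelian,
nontrivial `G_k` as in Asayama 2026 Cor. 1.5 — refutes the closed fact `Thm_1_11_slim`.
[cite: Asayama2026KummerFaithfulFG, Cor 1.5] -/
theorem not_Thm_1_11_slim_of_exists
    (hex : ∃ (k : Type u) (_ : Field k), IsKummerFaithful k ∧ ¬ IsSlimGroup (Field.absoluteGaloisGroup k)) :
    ¬ Thm_1_11_slim.{u} := by
  obtain ⟨k, _, hk, hns⟩ := hex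
  exact fun h => hns (isSlimGroup_absoluteGaloisGroup_of_Thm_1_11_slim h k hk)

end Literature.AnabelianGeometry.AbsoluteAnabelian.AbsTopIII
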